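import Summits.QuantumFields.BalabanUV.Beta.EriceFlowEnclosureB12AsPrintedHistoryContagionShiftFlowZeroTangentLambda

/-!
# Beta / EriceFlowEnclosureB12AsPrintedHistoryContagionShiftFlowZeroTangentCocycle — ASYMPTOTIC FREEDOM IS CONTAGIOUS, part 75: THE TANGENT FLOW IS A MULTIPLICATIVE COCYCLE
# OVER THE FLOW, AND JULIA'S EQUATION.  FOR THE FLOW (part 14's package at e′): (§128) the ultraviolet TAIL of THE solution from scale k on is THE solution from the pin `h_k(e)`
# (d4-p2's `memFlow_tail` + part 13's uniqueness at the slid package, whenever `h_k(e) ≤ e′` — always from some scale on, and for every k if `2e ≤ e′`), so the tangent flow W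
# at e and the tangent flow Ŵ at the pin `h_k(e)` satisfy **`W_{k+m}(e) = W_k(e)·Ŵ_m(h_k e)` for every m** (`tangent_cocycle`: both `m ↦ W_{k+m}` and `m ↦ W_k·Ŵ_m` solve part 66's
# linear equation at the tail WITH SOURCE `W_k` — `fixedPoint_unique`; under the gradient profile `hG` alone); (§129) for every dynamical Abel function Λ with the ABEL EQUATION
# `Λ(h_k e) = Λ(e) + kβ₀` (part 35's relative Λ) and the C¹ letters `hG`, `hGB`: **JULIA'S EQUATION `Λ′(h_k e)·∂_e h_k(e) = Λ′(e)`** at every interior pin with `h_k e < e′`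
# (`julia_deriv` — the chain rule, both factors now genuine derivatives by parts 69–70), hence the cocycle passes to the ultraviolet limit: **`Ŵ_∞(h_k e)·W_k(e) = W_∞(e)`**
# (`tangentLimit_cocycle`) — the infinitesimal form of «the Λ-coordinate is RG time»: `∂_e Λ` transported along the trajectory by the tangent flow
# (β-flow team, prover 1, unit `b2b-balaban-beta-bflow-p1`, gen 42; ROW AP-I·Uc × NODE U2)

HONEST FRAMING (page 1 of everything the β sub-cell writes): discharging `BetaPertH` makes Bałaban's UV stability UNCONDITIONAL — a
real constructive-QFT result; it is NOT the continuum limit and NOT the Clay problem.  HONEST DEPENDENCY (cell reorg 2026-08-19,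
verbatim): «continuum YM on T⁴ ⇐ BetaPertH ∧ nine spine estimates (0/9 proved); BetaPertH ⇐ (D1) ∧ (D4) ∧ CAP+tail; G-an2-4 gates
asym, D1 and NE2/3/4.»  THIS MODULE DISCHARGES NOTHING: [folklore] bookkeeping (re-indexing a finite sum, part 66's uniqueness, the chain rule `HasDerivAt.comp` and uniqueness
of derivatives) over node U2's HYPOTHESIS SHAPES and `solution`, d4-p2's `EriceRemainderEnclosureHistoryAutonomyOrder.memFlow_tail`, part 13's
`eq_solution_of_memFlow_of_reference`, parts 66–70, all BY NAME (NOT PRINTED for [I] = T. Bałaban, Commun. Math. Phys. **109** (1987) [Balaban1987RG1]: p. 298, (0.20)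
p. 256, Theorem 2 (0.31) p. 259 STATED WITHOUT PROOF).  The C¹ shape and the Abel equation are explicit binders.  «Julia's equation» names the classical identity of iteration
theory — OUR READING.  Nothing of Bałaban's β is asserted.

WHAT THIS FILE PROVES (0 sorry, 0 def): §128 **`solution_tail`**, `solution_tail_of_le_half`, **`tangent_cocycle`**; §129 **`julia_deriv`**, **`tangentLimit_cocycle`**.  NOT CLAIMED:
anything about Bałaban's β; `BetaPertH`; the continuum limit of the measures; Clay.
-/

namespace Summit.QuantumFields.BalabanUV.Beta.EriceFlowEnclosureB12AsPrintedHistoryContagionShiftFlowZeroTangentCocycle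

open Finset Filter Topology Set
open Literature.MathematicalPhysics.QuantumFieldTheory.Balaban1983to89
open Literature.MathematicalPhysics.QuantumFieldTheory.Balaban1983to89.T4CouplingMatching (sprof)
open Literature.MathematicalPhysics.QuantumFieldTheory.Balaban1983to89.T4BetaStationary (SeqBox MemoryProfile)
open Literature.MathematicalPhysics.QuantumFieldTheory.Balaban1983to89.T4BetaFlowWellPosed (MemFlow solution seqBox_shift)
open Summit.QuantumFields.BalabanUV.Beta.EriceRemainderEnclosureHistoryAutonomyOrder (memFlow_tail)
open Summit.QuantumFields.BalabanUV.Beta.EriceFlowEnclosureB12AsPrintedHistoryContagionShiftFlowPicardLimit (eq_solution_of_memFlow_of_reference)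
open Summit.QuantumFields.BalabanUV.Beta.EriceFlowEnclosureB12AsPrintedHistoryContagionShiftFlowZeroOffset (package_of_le)
open Summit.QuantumFields.BalabanUV.Beta.EriceFlowEnclosureB12AsPrintedHistoryContagionShiftFlowZeroTangent (fixedPoint_unique)
open Summit.QuantumFields.BalabanUV.Beta.EriceFlowEnclosureB12AsPrintedHistoryContagionShiftFlowZeroTangentLimit (profWeight_nonneg profWeight_anti
  sum_profWeight_le)
open Summit.QuantumFields.BalabanUV.Beta.EriceFlowEnclosureB12AsPrintedHistoryContagionShiftFlowZeroTangentFlow (solution_facts tangent_data smallness_of_hs5)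
open Summit.QuantumFields.BalabanUV.Beta.EriceFlowEnclosureB12AsPrintedHistoryContagionShiftFlowZeroTangentDeriv (hasDerivAt_solution)
open Summit.QuantumFields.BalabanUV.Beta.EriceFlowEnclosureB12AsPrintedHistoryContagionShiftFlowZeroTangentLambda (hasDerivAt_dynAbel differentiableAt_dynAbel)

noncomputable section

/-! ## §128 The tail of the solution and the cocycle of the tangent flow -/

/-- **THE ULTRAVIOLET TAIL OF THE SOLUTION IS THE SOLUTION FROM THE RUNNING COUPLING**: part 14's package at e′, `e ∈ ]0, e′]`, `h = solution B e`, and a scale k with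
`h_k ≤ e′`; then `solution B (h_k) = (h_{k+j})_j` (d4-p2's `memFlow_tail` gives a box solution from the pin `h_k`; part 13's uniqueness at the package slid to `h_k`).
[cite: Balaban1987RG1, (0.20) p.256 with p.298] -/
theorem solution_tail {B : (ℕ → ℝ) → ℝ} {Cm θ γ bs ta gs e' : ℝ} {t : ℕ → ℝ}
    (hB : MemoryProfile Cm θ γ B) (hCm : 0 ≤ Cm) (hθ0 : 0 ≤ θ) (hθ1 : θ < 1) (hbs : 0 < bs) (hta : 0 < ta)
    (hts : SeqBox γ t) (htf : MemFlow B gs t) (hprof : ∀ m : ℕ, 1 / ta ^ 2 + bs * (m : ℝ) ≤ 1 / (t m) ^ 2)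
    (h2e' : 2 * e' ≤ γ) (hs1 : 4 * Cm * e' ≤ bs * (1 - θ))
    (hs2 : e' ^ 2 * (1 / gs ^ 2 + Cm * γ / (1 - θ) ^ 2 + (2 * Cm / ((1 - θ) * bs)) ^ 2) ≤ 3 / 4)
    (hs4 : 64 * Cm * e' ^ 3 ≤ (1 - θ) ^ 2) (hs5 : Cm * (8 * e' ^ 3 + 16 * e' / bs) ≤ (1 - θ) / 4)
    {e : ℝ} (he : e ∈ Ioc (0 : ℝ) e') {k : ℕ} (hk : solution B e k ≤ e') :
    solution B (solution B e k) = fun j => solution B e (k + j) := by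
  have hγ : 0 ≤ γ := by linarith [he.1, he.2]
  obtain ⟨hsb, hsf, -⟩ := solution_facts hB hCm hθ0 hθ1 hbs hta hts htf hprof h2e' hs1 hs2 hs4 hs5 he
  have hx : solution B e k ∈ Ioc (0 : ℝ) e' := ⟨(hsb k).1, hk⟩
  obtain ⟨p1, p2, p4, -⟩ := package_of_le (gs := gs) hCm hθ1 hbs hγ hx.1 hx.2 hs1 hs2 hs4 hs5
  have h2x : 2 * solution B e k ≤ γ := by linarith [hx.2]
  exact (eq_solution_of_memFlow_of_reference hB hCm hθ0 hθ1 hbs hta hts htf hprof hx.1 h2x p1 p2 p4 (seqBox_shift hsb k) (memFlow_tail hsf k)).symm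

/-- If `2e ≤ e′` the tail identity holds at EVERY scale (the solution stays below 2e). [cite: Balaban1987RG1, (0.20) p.256 with p.298] -/
theorem solution_tail_of_le_half {B : (ℕ → ℝ) → ℝ} {Cm θ γ bs ta gs e' : ℝ} {t : ℕ → ℝ}
    (hB : MemoryProfile Cm θ γ B) (hCm : 0 ≤ Cm) (hθ0 : 0 ≤ θ) (hθ1 : θ < 1) (hbs : 0 < bs) (hta : 0 < ta)
    (hts : SeqBox γ t) (htf : MemFlow B gs t) (hprof : ∀ m : ℕ, 1 / ta ^ 2 + bs * (m : ℝ) ≤ 1 / (t m) ^ 2)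
    (h2e' : 2 * e' ≤ γ) (hs1 : 4 * Cm * e' ≤ bs * (1 - θ))
    (hs2 : e' ^ 2 * (1 / gs ^ 2 + Cm * γ / (1 - θ) ^ 2 + (2 * Cm / ((1 - θ) * bs)) ^ 2) ≤ 3 / 4)
    (hs4 : 64 * Cm * e' ^ 3 ≤ (1 - θ) ^ 2) (hs5 : Cm * (8 * e' ^ 3 + 16 * e' / bs) ≤ (1 - θ) / 4)
    {e : ℝ} (he : e ∈ Ioc (0 : ℝ) e') (h2e : 2 * e ≤ e') (k : ℕ) :
    solution B e k ≤ e' ∧ solution B (solution B e k) = fun j => solution B e (k + j) := by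
  obtain ⟨-, -, -, -, h2, -⟩ := solution_facts hB hCm hθ0 hθ1 hbs hta hts htf hprof h2e' hs1 hs2 hs4 hs5 he
  have hk : solution B e k ≤ e' := (h2 k).trans h2e
  exact ⟨hk, solution_tail hB hCm hθ0 hθ1 hbs hta hts htf hprof h2e' hs1 hs2 hs4 hs5 he hk⟩

/-- **THE TANGENT FLOW IS A MULTIPLICATIVE COCYCLE OVER THE FLOW.**  Part 14's package at e′; the gradient profile `hG`; `e ∈ ]0, e′]` and a scale k with `h_k(e) ≤ e′`; W the
tangent flow at e and Ŵ the tangent flow at the pin `h_k(e)` (each: its equation + `|·| ≤ 2`).  THEN **`W_{k+m} = W_k · Ŵ_m` for every m** — `m ↦ W_{k+m}` and `m ↦ W_k·Ŵ_m` both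
solve part 66's linear memory equation along the tail with the constant source `W_k`; part 66's `fixedPoint_unique`.  (The classical `∂g_{k+m}∕∂g_0 = ∂g_{k+m}∕∂g_k · ∂g_k∕∂g_0`
read in the chart.) [cite: Balaban1987RG1, Thm 2 (0.31) p.259 with (0.20) p.256 and p.298] -/
theorem tangent_cocycle {B : (ℕ → ℝ) → ℝ} {G : (ℕ → ℝ) → ℕ → ℝ} {Cm θ γ bs ta gs e' : ℝ} {t W WW : ℕ → ℝ}
    (hB : MemoryProfile Cm θ γ B) (hCm : 0 ≤ Cm) (hθ0 : 0 ≤ θ) (hθ1 : θ < 1) (hbs : 0 < bs) (hta : 0 < ta)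
    (hts : SeqBox γ t) (htf : MemFlow B gs t) (hprof : ∀ m : ℕ, 1 / ta ^ 2 + bs * (m : ℝ) ≤ 1 / (t m) ^ 2)
    (hG : ∀ u : ℕ → ℝ, SeqBox γ u → ∀ j, |G u j| ≤ Cm * θ ^ j)
    (h2e' : 2 * e' ≤ γ) (hs1 : 4 * Cm * e' ≤ bs * (1 - θ))
    (hs2 : e' ^ 2 * (1 / gs ^ 2 + Cm * γ / (1 - θ) ^ 2 + (2 * Cm / ((1 - θ) * bs)) ^ 2) ≤ 3 / 4)
    (hs4 : 64 * Cm * e' ^ 3 ≤ (1 - θ) ^ 2) (hs5 : Cm * (8 * e' ^ 3 + 16 * e' / bs) ≤ (1 - θ) / 4)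
    {e : ℝ} (he : e ∈ Ioc (0 : ℝ) e') {k : ℕ} (hk : solution B e k ≤ e')
    (hW : ∀ n, W n = 1 - ∑ p ∈ range n, ∑' j, G (fun i => solution B e (p + 1 + i)) j * ((solution B e (p + 1 + j)) ^ 3 / 2) * W (p + 1 + j))
    (hWM : ∀ n, |W n| ≤ 2)
    (hWW : ∀ m, WW m = 1 - ∑ p ∈ range m, ∑' j,
      G (fun i => solution B (solution B e k) (p + 1 + i)) j * ((solution B (solution B e k) (p + 1 + j)) ^ 3 / 2) * WW (p + 1 + j))
    (hWWM : ∀ m, |WW m| ≤ 2) (m : ℕ) : W (k + m) = W k * WW m := by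
  have he' : 0 < e' := he.1.trans_le he.2
  set h : ℕ → ℝ := solution B e with hdef
  set x : ℝ := solution B e k with hxdef
  obtain ⟨hsb, -, -, -, -, -⟩ := solution_facts hB hCm hθ0 hθ1 hbs hta hts htf hprof h2e' hs1 hs2 hs4 hs5 he
  have hx : x ∈ Ioc (0 : ℝ) e' := ⟨(hsb k).1, hk⟩
  obtain ⟨hsbx, -, -, -, -, hcubex⟩ := solution_facts hB hCm hθ0 hθ1 hbs hta hts htf hprof h2e' hs1 hs2 hs4 hs5 hx
  obtain ⟨hc, hv⟩ := tangent_data (B := B) (e' := e') hG hsbx hcubex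
  obtain ⟨-, hq, -⟩ := smallness_of_hs5 (Cm := Cm) (bs := bs) (e' := e') hθ1 hs5
  have htail : solution B x = fun j => h (k + j) := solution_tail hB hCm hθ0 hθ1 hbs hta hts htf hprof h2e' hs1 hs2 hs4 hs5 he hk
  -- U m := W (k+m) solves the tail equation with source W k
  have hU : ∀ m, (fun m => W (k + m)) m = (fun _ : ℕ => W k) m - ∑ p ∈ range m, ∑' j,
      G (fun i => solution B x (p + 1 + i)) j * ((solution B x (p + 1 + j)) ^ 3 / 2) * (fun m => W (k + m)) (p + 1 + j) := by
    intro m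
    simp only [htail]
    have h1 := hW (k + m)
    rw [Finset.sum_range_add, ← sub_sub, ← hW k] at h1
    rw [h1]
    congr 1
    refine Finset.sum_congr rfl fun p _ => tsum_congr fun j => ?_
    rw [show k + p + 1 + j = k + (p + 1 + j) by omega, show (fun i => h (k + p + 1 + i)) = fun i => h (k + (p + 1 + i)) from
      funext fun i => by rw [show k + p + 1 + i = k + (p + 1 + i) by omega]]
  -- U′ m := W k · Ŵ m solves the same equation
  have hU' : ∀ m, (fun m => W k * WW m) m = (fun _ : ℕ => W k) m - ∑ p ∈ range m, ∑' j,
      G (fun i => solution B x (p + 1 + i)) j * ((solution B x (p + 1 + j)) ^ 3 / 2) * (fun m => W k * WW m) (p + 1 + j) := by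
    intro m
    simp only []
    rw [hWW m, mul_sub, mul_one, Finset.mul_sum]
    congr 1
    refine Finset.sum_congr rfl fun p _ => ?_
    rw [← tsum_mul_left]
    exact tsum_congr fun j => by ring
  have hUM : ∀ m, |(fun m => W (k + m)) m| ≤ 2 := fun m => hWM (k + m)
  have hU'M : ∀ m, |(fun m => W k * WW m)  m| ≤ 4 := fun m => by
    show |W k * WW m| ≤ 4
    rw [abs_mul]; nlinarith [hWM k, hWWM m, abs_nonneg (W k), abs_nonneg (WW m)]
  have heq := fixedPoint_unique (s := fun _ : ℕ => W k) hCm hθ0 hθ1 (profWeight_nonneg hbs he') (fun hab => profWeight_anti hbs he' hab)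
    (sum_profWeight_le hbs he') hq hc hv hU hUM hU' hU'M
  exact congrFun heq m

/-! ## §129 Julia's equation and the cocycle in the ultraviolet limit -/

/-- **JULIA'S EQUATION.**  Part 14's package at e′; the C¹ letters `hG`, `hGB`; Λ a dynamical Abel function (part 44's interface) WITH THE ABEL EQUATION `Λ(h_k e) = Λ(e) + kβ₀`
along the solutions (part 35's relative Λ); an interior pin e and a scale k with `h_k(e) < e′`.  THEN **`Λ′(h_k e) · ∂_e h_k(e) = Λ′(e)`** — the chain rule applied to the Abel
equation, both derivatives genuine (parts 69–70); here `∂_e h_k(e) = W_k h_k³∕e³` for the tangent flow W at e. [cite: Balaban1987RG1, Thm 2 (0.31) p.259 with (0.20) p.256] -/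
theorem julia_deriv {B : (ℕ → ℝ) → ℝ} {G : (ℕ → ℝ) → ℕ → ℝ} {Cm θ γ β₀ bs ta gs e' : ℝ} {t W : ℕ → ℝ} {a : ℕ → ℝ} {Λ : ℝ → ℝ}
    (hB : MemoryProfile Cm θ γ B) (hCm : 0 ≤ Cm) (hθ0 : 0 ≤ θ) (hθ1 : θ < 1) (hbs : 0 < bs) (hta : 0 < ta)
    (hts : SeqBox γ t) (htf : MemFlow B gs t) (hprof : ∀ m : ℕ, 1 / ta ^ 2 + bs * (m : ℝ) ≤ 1 / (t m) ^ 2)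
    (hG : ∀ u : ℕ → ℝ, SeqBox γ u → ∀ j, |G u j| ≤ Cm * θ ^ j)
    (hGB : ∀ ε > 0, ∃ ρ > 0, ∀ u u' : ℕ → ℝ, SeqBox γ u → SeqBox γ u' → (∀ j, |u' j - u j| ≤ ρ) →
      |B u' - B u - ∑' j, G u j * (u' j - u j)| ≤ ε * ∑' j, θ ^ j * |u' j - u j|)
    (hΛ : ∀ e ∈ Ioc (0 : ℝ) e', ∀ h : ℕ → ℝ, SeqBox γ h → MemFlow B e h → Tendsto (fun n => 1 / h n ^ 2 - a n) atTop (𝓝 (Λ e)))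
    (habel : ∀ e ∈ Ioc (0 : ℝ) e', ∀ k : ℕ, Λ (solution B e k) = Λ e + (k : ℝ) * β₀)
    (h2e' : 2 * e' ≤ γ) (hs1 : 4 * Cm * e' ≤ bs * (1 - θ))
    (hs2 : e' ^ 2 * (1 / gs ^ 2 + Cm * γ / (1 - θ) ^ 2 + (2 * Cm / ((1 - θ) * bs)) ^ 2) ≤ 3 / 4)
    (hs4 : 64 * Cm * e' ^ 3 ≤ (1 - θ) ^ 2) (hs5 : Cm * (8 * e' ^ 3 + 16 * e' / bs) ≤ (1 - θ) / 4)
    {e : ℝ} (he : e ∈ Ioo (0 : ℝ) e') {k : ℕ} (hk : solution B e k < e')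
    (hW : ∀ n, W n = 1 - ∑ p ∈ range n, ∑' j, G (fun i => solution B e (p + 1 + i)) j * ((solution B e (p + 1 + j)) ^ 3 / 2) * W (p + 1 + j))
    (hWM : ∀ n, |W n| ≤ 2) :
    deriv Λ (solution B e k) * (W k * (solution B e k) ^ 3 / e ^ 3) = deriv Λ e ∧
      deriv (fun x : ℝ => solution B x k) e = W k * (solution B e k) ^ 3 / e ^ 3 := by
  have hec : e ∈ Ioc (0 : ℝ) e' := ⟨he.1, he.2.le⟩
  obtain ⟨hsb, -⟩ := solution_facts hB hCm hθ0 hθ1 hbs hta hts htf hprof h2e' hs1 hs2 hs4 hs5 hec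
  have hx : solution B e k ∈ Ioo (0 : ℝ) e' := ⟨(hsb k).1, hk⟩
  have hsol := (hasDerivAt_solution hB hCm hθ0 hθ1 hbs hta hts htf hprof hG hGB h2e' hs1 hs2 hs4 hs5 he hW hWM k).1
  have hΛx := (differentiableAt_dynAbel hB hCm hθ0 hθ1 hbs hta hts htf hprof hG hGB hΛ h2e' hs1 hs2 hs4 hs5 hx).1.hasDerivAt
  have hΛe := (differentiableAt_dynAbel hB hCm hθ0 hθ1 hbs hta hts htf hprof hG hGB hΛ h2e' hs1 hs2 hs4 hs5 he).1.hasDerivAt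
  -- the composite Λ ∘ h_k has derivative Λ′(h_k e)·h_k′(e) …
  have hcomp : HasDerivAt (fun x : ℝ => Λ (solution B x k)) (deriv Λ (solution B e k) * (W k * (solution B e k) ^ 3 / e ^ 3)) e :=
    hΛx.comp e hsol
  -- … and equals Λ + kβ₀ near e, whose derivative is Λ′(e)
  have hshift : HasDerivAt (fun x : ℝ => Λ (solution B x k)) (deriv Λ e) e := by
    refine (hΛe.add_const ((k : ℝ) * β₀)).congr_of_eventuallyEq ?_
    exact Filter.eventually_of_mem (Ioo_mem_nhds he.1 he.2) fun x hx => habel x ⟨hx.1, hx.2.le⟩ k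
  exact ⟨hcomp.unique hshift, hsol.deriv⟩

/-- **THE COCYCLE IN THE ULTRAVIOLET LIMIT**: with `W_∞`, `Ŵ_∞` the ultraviolet limits of the tangent flows at e and at `h_k(e)`: **`Ŵ_∞(h_k e)·W_k(e) = W_∞(e)`** — Julia's equation
read through `Λ′(y) = −2Ŵ_∞∕y³` (part 70) and `∂_e h_k = W_k h_k³∕e³` (part 69). [cite: Balaban1987RG1, Thm 2 (0.31) p.259 with (0.20) p.256 and p.298] -/
theorem tangentLimit_cocycle {B : (ℕ → ℝ) → ℝ} {G : (ℕ → ℝ) → ℕ → ℝ} {Cm θ γ β₀ bs ta gs e' : ℝ} {t W WW : ℕ → ℝ} {a : ℕ → ℝ} {Λ : ℝ → ℝ}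
    (hB : MemoryProfile Cm θ γ B) (hCm : 0 ≤ Cm) (hθ0 : 0 ≤ θ) (hθ1 : θ < 1) (hbs : 0 < bs) (hta : 0 < ta)
    (hts : SeqBox γ t) (htf : MemFlow B gs t) (hprof : ∀ m : ℕ, 1 / ta ^ 2 + bs * (m : ℝ) ≤ 1 / (t m) ^ 2)
    (hG : ∀ u : ℕ → ℝ, SeqBox γ u → ∀ j, |G u j| ≤ Cm * θ ^ j)
    (hGB : ∀ ε > 0, ∃ ρ > 0, ∀ u u' : ℕ → ℝ, SeqBox γ u → SeqBox γ u' → (∀ j, |u' j - u j| ≤ ρ) →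
      |B u' - B u - ∑' j, G u j * (u' j - u j)| ≤ ε * ∑' j, θ ^ j * |u' j - u j|)
    (hΛ : ∀ e ∈ Ioc (0 : ℝ) e', ∀ h : ℕ → ℝ, SeqBox γ h → MemFlow B e h → Tendsto (fun n => 1 / h n ^ 2 - a n) atTop (𝓝 (Λ e)))
    (habel : ∀ e ∈ Ioc (0 : ℝ) e', ∀ k : ℕ, Λ (solution B e k) = Λ e + (k : ℝ) * β₀)
    (h2e' : 2 * e' ≤ γ) (hs1 : 4 * Cm * e' ≤ bs * (1 - θ))
    (hs2 : e' ^ 2 * (1 / gs ^ 2 + Cm * γ / (1 - θ) ^ 2 + (2 * Cm / ((1 - θ) * bs)) ^ 2) ≤ 3 / 4)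
    (hs4 : 64 * Cm * e' ^ 3 ≤ (1 - θ) ^ 2) (hs5 : Cm * (8 * e' ^ 3 + 16 * e' / bs) ≤ (1 - θ) / 4)
    {e : ℝ} (he : e ∈ Ioo (0 : ℝ) e') {k : ℕ} (hk : solution B e k < e')
    (hW : ∀ n, W n = 1 - ∑ p ∈ range n, ∑' j, G (fun i => solution B e (p + 1 + i)) j * ((solution B e (p + 1 + j)) ^ 3 / 2) * W (p + 1 + j))
    (hWM : ∀ n, |W n| ≤ 2) {Winf : ℝ} (hWinf : Tendsto W atTop (𝓝 Winf))
    (hWW : ∀ m, WW m = 1 - ∑ p ∈ range m, ∑' j,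
      G (fun i => solution B (solution B e k) (p + 1 + i)) j * ((solution B (solution B e k) (p + 1 + j)) ^ 3 / 2) * WW (p + 1 + j))
    (hWWM : ∀ m, |WW m| ≤ 2) {WWinf : ℝ} (hWWinf : Tendsto WW atTop (𝓝 WWinf)) :
    WWinf * W k = Winf := by
  have hec : e ∈ Ioc (0 : ℝ) e' := ⟨he.1, he.2.le⟩
  obtain ⟨hsb, -⟩ := solution_facts hB hCm hθ0 hθ1 hbs hta hts htf hprof h2e' hs1 hs2 hs4 hs5 hec
  set y : ℝ := solution B e k with hy
  have hx : y ∈ Ioo (0 : ℝ) e' := ⟨(hsb k).1, hk⟩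
  have hJ := (julia_deriv hB hCm hθ0 hθ1 hbs hta hts htf hprof hG hGB hΛ habel h2e' hs1 hs2 hs4 hs5 he hk hW hWM).1
  have hde : deriv Λ e = Winf * (-2 / e ^ 3) :=
    (hasDerivAt_dynAbel hB hCm hθ0 hθ1 hbs hta hts htf hprof hG hGB hΛ h2e' hs1 hs2 hs4 hs5 he hW hWM hWinf).deriv
  have hdy : deriv Λ y = WWinf * (-2 / y ^ 3) :=
    (hasDerivAt_dynAbel hB hCm hθ0 hθ1 hbs hta hts htf hprof hG hGB hΛ h2e' hs1 hs2 hs4 hs5 hx hWW hWWM hWWinf).deriv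
  rw [hde, hdy] at hJ
  have hy3 : y ^ 3 ≠ 0 := pow_ne_zero 3 hx.1.ne'
  have he3 : e ^ 3 ≠ 0 := pow_ne_zero 3 he.1.ne'
  have h1 : WWinf * (-2 / y ^ 3) * (W k * y ^ 3 / e ^ 3) = (WWinf * W k) * (-2 / e ^ 3) * (y ^ 3 / y ^ 3) := by ring
  rw [h1, div_self hy3, mul_one] at hJ
  have hne : (-2 : ℝ) / e ^ 3 ≠ 0 := div_ne_zero (by norm_num) he3
  exact mul_right_cancel₀ hne hJ

end

end Summit.QuantumFields.BalabanUV.Beta.EriceFlowEnclosureB12AsPrintedHistoryContagionShiftFlowZeroTangentCocycle
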